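import Summits.BirchSwinnertonDyer.BirchSwinnertonDyer.Theorems.ManinLocalTwoThreeBracketSturmOneTwelveA
import Summits.BirchSwinnertonDyer.BirchSwinnertonDyer.Theorems.ManinLocalTwoThreeBracketSturmOneTwelveB
import Summits.BirchSwinnertonDyer.BirchSwinnertonDyer.Theorems.ManinLocalTwoThreeBracketSturmOneTwelveC
import Summits.BirchSwinnertonDyer.BirchSwinnertonDyer.Theorems.ManinLocalTwoThreeNewformPinningOneTwelve
import Summits.BirchSwinnertonDyer.BirchSwinnertonDyer.Theorems.ManinLocalTwoThreeExistsMinimalOptimalDatum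
import Literature.NumberTheory.EllipticCurves.Gamma0RankinSelbergPairing
import HarnessLib

/-!
# Level 112 = 2⁴·7 (C2 domain, `16 ∣ 112`, genus 11, THREE classes `112a–c`) COMPLETE: `|c| = 1` — hence `2 ∤ c` — for EVERY lattice-optimal `X₀(112)`-datum of
# EVERY globally minimal elliptic curve over `ℚ`, UNCONDITIONALLY

Cell `bsd-f2-manin`, route `ManinLocalTwoThree`, crux C2 `ManinOddAtFour` (stmt-BirchSwinnertonDyer-22967: `2² ∣ 112`); prover seat p2 gen 30; `--supports` (helper).
ASSEMBLY: p1 gen 25's fact-free pinning `LevelOneTwelve.f_apply_eq_oneTwelve` (the newform of every `X₀(112)`-datum is one of three explicit `η`-combinations,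
classes `112a`, `112b`, `112c`) composed with this seat's three Bracket–Sturm certificates `…BracketSturmOneTwelveA/B/C` (depth `193`, STAGED kernel tables
of the thirteen quotients `P1..P5`, `G1..G8`) — whose `hf` hypotheses are p1's disjuncts VERBATIM — gives **`|c| = 1` and `2 ∤ c` on `X₀(112)`**; the domain is
inhabited under the item's binder `exists_isNewformOf` (`N(112b1) = 112` by kernel Tate certificate).  HONEST FRAMING: unconditional (standard axioms); ONE
level of C2 — nothing here proves C2 for all `N`, Manin's conjecture or BSD; item 22967 stays OPEN as filed.
[cite: Manin1972, Prop. 1.4] [cite: Sturm1987, Thm. 1] [cite: AgasheRibetStein2006, §§1–2] [cite: CremonaAlgorithms1997, §2.10, Table 1 (112a1–112c1)] [cite: EdixhovenManin1991, Prop. 2]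
-/

set_option autoImplicit false
-- lint-debt: the directory name repeats the summit name (sibling precedent `ManinLocalTwoThreeManinConstantEightyEight.lean`)
set_option linter.dupNamespace false

noncomputable section

open Complex Filter Topology Set Function
open UpperHalfPlane hiding I
open scoped Real Topology MatrixGroups ModularForm
open ModularForm CongruenceSubgroup
open Literature.NumberTheory.ModularForms
open Literature.NumberTheory.EllipticCurves Literature.NumberTheory.EllipticCurves.ModularForms
open Literature.NumberTheory.Automorphic

namespace Summit.BirchSwinnertonDyer.BirchSwinnertonDyer.Theorems.ManinLocalTwoThree.LevelOneTwelveCert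

/-- **`|c| = 1` for every lattice-optimal `X₀(112)`-datum of every globally minimal elliptic `W/ℚ`** — UNCONDITIONAL (p1's pinning + the three Bracket–Sturm
certificates). [cite: Manin1972, Prop. 1.4] [cite: AgasheRibetStein2006, §§1–2] -/
theorem abs_maninConstant_eq_one_oneTwelve (W : WeierstrassCurve ℚ) [W.IsElliptic] [W.IsGloballyMinimal]
    (D : ModularParametrizationData W 112) (hopt : ∀ z ∈ D.L.lattice, ∃ w ∈ periodLattice D.f, z = D.c * w) :
    |D.maninConstant| = 1 := by
  rcases LevelOneTwelve.f_apply_eq_oneTwelve D with hf | hf | hf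
  · exact abs_maninConstant_eq_one_oneTwelveA_of_pinned W D hopt hf
  · exact abs_maninConstant_eq_one_oneTwelveB_of_pinned W D hopt hf
  · exact abs_maninConstant_eq_one_oneTwelveC_of_pinned W D hopt hf

/-- **C2 `ManinOddAtFour` at `N = 112` (`2² ∣ 112`): `2 ∤ c(D)`** for every lattice-optimal `X₀(112)`-datum — UNCONDITIONAL. [cite: AgasheRibetStein2006, §§1–2] -/
theorem not_two_dvd_maninConstant_oneTwelve (W : WeierstrassCurve ℚ) [W.IsElliptic] [W.IsGloballyMinimal]
    (D : ModularParametrizationData W 112) (hopt : ∀ z ∈ D.L.lattice, ∃ w ∈ periodLattice D.f, z = D.c * w) :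
    ¬ (2 : ℤ) ∣ D.maninConstant := by
  have h := abs_maninConstant_eq_one_oneTwelve W D hopt
  intro h2
  have := Int.le_of_dvd (by rw [h]; norm_num) ((dvd_abs _ _).mpr h2)
  rw [h] at this
  norm_num at this

/-- **No prime divides `c` on `X₀(112)`.** [cite: AgasheRibetStein2006, §§1–2] -/
theorem not_prime_dvd_maninConstant_oneTwelve (W : WeierstrassCurve ℚ) [W.IsElliptic] [W.IsGloballyMinimal]
    (D : ModularParametrizationData W 112) (hopt : ∀ z ∈ D.L.lattice, ∃ w ∈ periodLattice D.f, z = D.c * w)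
    {p : ℕ} (hp : p.Prime) : ¬ (p : ℤ) ∣ D.maninConstant := by
  have h := abs_maninConstant_eq_one_oneTwelve W D hopt
  intro hpd
  have h1 := Int.le_of_dvd (by rw [h]; norm_num) ((dvd_abs _ _).mpr hpd)
  rw [h] at h1
  have := hp.two_le
  omega

/-- **The C2 conclusion on the whole `X₀(112)`-domain**: `2² ∣ 112`, and `|c| = 1 ∧ 2 ∤ c` for every lattice-optimal `X₀(112)`-datum of every globally minimal
elliptic curve over `ℚ` — UNCONDITIONAL; BSD and C2 for general `N` are NOT proved by this. [folklore] -/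
theorem maninOddAtFour_oneTwelve :
    2 ^ 2 ∣ 112 ∧ ∀ (W : WeierstrassCurve ℚ) [W.IsElliptic] [W.IsGloballyMinimal] (D : ModularParametrizationData W 112),
      (∀ z ∈ D.L.lattice, ∃ w ∈ periodLattice D.f, z = D.c * w) → |D.maninConstant| = 1 ∧ ¬ (2 : ℤ) ∣ D.maninConstant :=
  ⟨⟨28, by norm_num⟩, fun W _ _ D hopt ↦ ⟨abs_maninConstant_eq_one_oneTwelve W D hopt, not_two_dvd_maninConstant_oneTwelve W D hopt⟩⟩

/-- **Modularity at `112b1`, levelled**: under `exists_isNewformOf` the curve `[0, 0, 0, 1, −2]` has a newform in `S₂(Γ₀(112))`. CONDITIONAL on the item's own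
binder. [cite: DiamondShurman2005, Thm. 8.8.3] -/
theorem exists_isNewformOf_oneTwelveB1 (hnf : exists_isNewformOf) :
    ∃ f : CuspForm (Gamma0 112) 2, IsNewformOf (⟨0, 0, 0, 1, -2⟩ : WeierstrassCurve ℚ) f := by
  haveI := isElliptic_oneTwelveB1
  have key : ∀ (N : ℕ) [NeZero N], (⟨0, 0, 0, 1, -2⟩ : WeierstrassCurve ℚ).conductorNorm ℤ = N →
      ∃ f : CuspForm (Gamma0 N) 2, IsNewformOf (⟨0, 0, 0, 1, -2⟩ : WeierstrassCurve ℚ) f := by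
    intro N _ hN
    subst hN
    exact hnf _
  haveI : NeZero (112 : ℕ) := ⟨by decide⟩
  exact key 112 conductorNorm_oneTwelveB1

/-- **A lattice-optimal `X₀(112)`-datum on a globally minimal model in the class `112b` exists under modularity**, with `|c| = 1` and `2 ∤ c`; CONDITIONAL on
`exists_isNewformOf` only. [cite: EdixhovenManin1991, Prop. 2] -/
theorem domain_inhabited_oneTwelve_of_modularity (hnf : exists_isNewformOf) :
    ∃ (W₀ : WeierstrassCurve ℚ) (_ : W₀.IsElliptic) (_ : W₀.IsGloballyMinimal) (D₀ : ModularParametrizationData W₀ 112),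
      (⟨0, 0, 0, 1, -2⟩ : WeierstrassCurve ℚ).IsIsogenous W₀ ∧ (∀ z ∈ D₀.L.lattice, ∃ w ∈ periodLattice D₀.f, z = D₀.c * w) ∧
      |D₀.maninConstant| = 1 ∧ ¬ (2 : ℤ) ∣ D₀.maninConstant := by
  haveI := isElliptic_oneTwelveB1
  haveI : NeZero (112 : ℕ) := ⟨by decide⟩
  obtain ⟨f, hf⟩ := exists_isNewformOf_oneTwelveB1 hnf
  obtain ⟨D⟩ := nonempty_modularParametrizationData_of_isNewformOf hf
  obtain ⟨W₀, h₀, hmin, D₀, -, hiso, hopt, -⟩ :=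
    ExistsMinimalOptimalDatum.existsMinimalOptimalDatum_full (⟨0, 0, 0, 1, -2⟩ : WeierstrassCurve ℚ) D
  exact ⟨W₀, h₀, hmin, D₀, hiso, hopt, @abs_maninConstant_eq_one_oneTwelve W₀ h₀ hmin D₀ hopt,
    @not_two_dvd_maninConstant_oneTwelve W₀ h₀ hmin D₀ hopt⟩

end Summit.BirchSwinnertonDyer.BirchSwinnertonDyer.Theorems.ManinLocalTwoThree.LevelOneTwelveCert

end
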